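import Summits.QuantumAdvantage.QuantumAdvantage.Theses.OddPrimeWalk

/-!
# Route OddPrimeWalk — glue `DenseResidualOddGlue` (item stmt-QuantumAdvantage-22959), proved

`DenseResidualOddGlue := DenseResidualSqrtOdd → ShotsSqrtOdd → DenseResidualOdd` (the gen-1 split of the
crux `DenseResidualOdd` at the √n threshold, planner qa-qnc0-p2 g15, route rev 6): for a strategy `y` let
`b := max_u #{g : y_g(u) = 1}` (`Finset.univ.sup`); if `b²(log₂ n)^{2C+3} ≤ n` the √n-shots rung `ShotsSqrtOdd`
applies with `B := b` (every input fires `≤ b` cuts, `Finset.le_sup`), otherwise the √n-dense residual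
`DenseResidualSqrtOdd` applies; `θ := max θ₁ θ₂`, `n₀ := max`.  The parent's own hypothesis
`¬ (b³(log₂ n)^{2C+2} ≤ n)` is not needed.  Pure bookkeeping (seat qa-qnc0-prover gen 10).
-/

set_option linter.dupNamespace false

namespace Summit.QuantumAdvantage.QuantumAdvantage.Theorems

open Finset

/-- Item stmt-QuantumAdvantage-22959 `DenseResidualOddGlue` of route OddPrimeWalk: the √n-dense residual and
the √n-shots rung together give the dense residual `DenseResidualOdd` (`θ := max θ₁ θ₂`; case split on
`b²(log₂ n)^{2C+3} ≤ n`, `b` the maximal shot count). -/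
theorem denseResidualOddGlue_proof :
    Summit.QuantumAdvantage.QuantumAdvantage.Theses.OddPrimeWalk.DenseResidualOddGlue := by
  intro hR hSh p _ hp
  obtain ⟨θ₁, hθ₁, h₁⟩ := hSh p hp
  obtain ⟨θ₂, hθ₂, h₂⟩ := hR p hp
  refine ⟨max θ₁ θ₂, max_lt hθ₁ hθ₂, fun C => ?_⟩
  obtain ⟨n₁, hn₁⟩ := h₁ C
  obtain ⟨n₂, hn₂⟩ := h₂ C
  refine ⟨max n₁ n₂, fun n hn c y hy _ => ?_⟩
  have h2n : (0 : ℝ) ≤ (2 : ℝ) ^ n := by positivity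
  -- the maximal shot count
  set b : ℕ := univ.sup fun u : Fin n → Bool => (univ.filter fun g : Fin (n + 1) => y g u = true).card
    with hb
  by_cases hcase : b ^ 2 * (Nat.log 2 n) ^ (2 * C + 3) ≤ n
  · have hshots : ∀ u : Fin n → Bool, (univ.filter fun g : Fin (n + 1) => y g u = true).card ≤ b :=
      fun u => Finset.le_sup (f := fun u : Fin n → Bool =>
        (univ.filter fun g : Fin (n + 1) => y g u = true).card) (mem_univ u)
    have h := hn₁ n (le_trans (le_max_left _ _) hn) c b y hy hshots hcase
    exact h.trans (mul_le_mul_of_nonneg_right (le_max_left _ _) h2n)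
  · have h := hn₂ n (le_trans (le_max_right _ _) hn) c y hy hcase
    exact h.trans (mul_le_mul_of_nonneg_right (le_max_right _ _) h2n)

end Summit.QuantumAdvantage.QuantumAdvantage.Theorems
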